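import Summits.Parity.GeneralizedHardyLittlewood.Theorems.LeeYangFibresModelHyperbolicityCalculus
import HarnessLib

/-!
# Route `LeeYangFibres`, support item `ModelCellFacts` (stmt-Parity-14111):
# growth bounds for the Alladi–Buchstab cell densities and the vanishing log-concavity margin

Helper file for the proof of `Summit.Parity.GeneralizedHardyLittlewood.Theses.LeeYangFibres.ModelCellFacts`.
All statements concern the densities `cellDensity i u = I_{i+1}(u)` of
`LeeYangFibresModelHyperbolicityDefs.lean` (`I_1 ≡ 1`, `I_{i+2}(u) = ∫_1^{max(u-1,1)} I_{i+1}(t) dt/t`):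

* `integral_log_sub_pow_div` — `∫_a^b (log t - C)^i dt/t = [(log t - C)^{i+1}/(i+1)]_a^b`;
* `cellDensity_le_pow_div_factorial` — `I_{i+1}(u) ≤ (log u)^i / i!` for `u ≥ 1`;
* `pow_div_factorial_le_cellDensity` — `(log u - i·log 2)^i / i! ≤ I_{i+1}(u)` for `u ≥ 2^i`
  (restrict the recursion to `t ∈ [2^i, u-1]` and use `log(u-1) ≥ log u - log 2`); together these give
  `limsup_u r_j(u) ≤ j/(j-1)` for `r_j(u) = I_j(u)²/(I_{j-1}(u)·I_{j+1}(u))` (classically `r_j(u) → j/(j-1)`,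
  since `I_j(u) ~ (log u)^{j-1}/(j-1)!`), whence
* `eventually_margin` — if `(1-ε)(k+2) < k+1` (a bulk index `j = k+2 > 1/ε`) then
  `(1-ε)·I_{k+2}(u)² < I_{k+1}(u)·I_{k+3}(u)` for all large real `u`.

References: K. Alladi, Quart. J. Math. Oxford (2) 33 (1982) 129–148 [Alladi1982]; G. Tenenbaum,
*Introduction to analytic and probabilistic number theory*, III.6 [Tenenbaum2015]. Only standard calculus
is used; no named facts.
-/

noncomputable section

namespace Summit.Parity.GeneralizedHardyLittlewood.Theorems.ModelCellFacts

open scoped BigOperators Topology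
open Filter Set MeasureTheory
open Summit.Parity.GeneralizedHardyLittlewood.Cruxes.ModelHyperbolicity.WindowChainTransport

/-! ## A logarithmic primitive -/

/-- `∫_a^b (log t - C)^i / t dt = ((log b - C)^{i+1} - (log a - C)^{i+1}) / (i+1)` for `0 < a ≤ b`. -/
theorem integral_log_sub_pow_div (i : ℕ) (C : ℝ) {a b : ℝ} (ha : 0 < a) (hab : a ≤ b) :
    ∫ t in a..b, (Real.log t - C) ^ i / t =
      ((Real.log b - C) ^ (i + 1) - (Real.log a - C) ^ (i + 1)) / (i + 1) := by
  have hderiv : ∀ x ∈ uIcc a b,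
      HasDerivAt (fun x => (Real.log x - C) ^ (i + 1) / (i + 1)) ((Real.log x - C) ^ i / x) x := by
    intro x hx
    rw [uIcc_of_le hab] at hx
    have hx0 : 0 < x := ha.trans_le hx.1
    have h := (((Real.hasDerivAt_log hx0.ne').sub_const C).fun_pow (i + 1)).div_const ((i : ℝ) + 1)
    refine h.congr_deriv ?_
    have hi : ((i : ℝ) + 1) ≠ 0 := by positivity
    rw [Nat.add_sub_cancel]
    push_cast
    field_simp
  have hcont : ContinuousOn (fun x => (Real.log x - C) ^ i / x) (uIcc a b) := by
    rw [uIcc_of_le hab]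
    refine ContinuousOn.div ((ContinuousOn.sub (Real.continuousOn_log.mono ?_) continuousOn_const).pow i)
      continuousOn_id fun x hx => (ha.trans_le hx.1).ne'
    intro x hx
    exact (ha.trans_le hx.1).ne'
  rw [intervalIntegral.integral_eq_sub_of_hasDerivAt hderiv (hcont.intervalIntegrable)]
  ring

/-! ## Upper and lower bounds for the densities -/

/-- **Upper bound**: `I_{i+1}(u) ≤ (log u)^i / i!` for `u ≥ 1`. -/
theorem cellDensity_le_pow_div_factorial (i : ℕ) :
    ∀ u : ℝ, 1 ≤ u → cellDensity i u ≤ Real.log u ^ i / i.factorial := by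
  induction i with
  | zero => intro u _; simp
  | succ i ih =>
    intro u hu
    set b : ℝ := max (u - 1) 1 with hb
    have hb1 : 1 ≤ b := le_max_right _ _
    have hbu : b ≤ u := max_le (by linarith) hu
    have hb0 : 0 < b := by linarith
    rw [calc_cellDensity_succ]
    have hfi : IntervalIntegrable (fun t => cellDensity i t / t) volume 1 b := by
      refine ContinuousOn.intervalIntegrable ?_
      rw [uIcc_of_le hb1]
      exact (calc_continuous i).continuousOn.div continuousOn_id fun t ht =>
        (show (0 : ℝ) < t by linarith [ht.1]).ne'
    have hgi : IntervalIntegrable (fun t => (1 / (i.factorial : ℝ)) * ((Real.log t - 0) ^ i / t))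
        volume 1 b := by
      refine ContinuousOn.intervalIntegrable ?_
      rw [uIcc_of_le hb1]
      refine continuousOn_const.mul ?_
      refine ContinuousOn.div ((ContinuousOn.sub (Real.continuousOn_log.mono ?_) continuousOn_const).pow i)
        continuousOn_id fun x hx => ?_
      · intro x hx; exact (ne_of_gt (by linarith [hx.1] : (0 : ℝ) < x))
      · exact (show (0 : ℝ) < x by linarith [hx.1]).ne'
    have hmono : ∫ t in (1 : ℝ)..b, cellDensity i t / t ≤
        ∫ t in (1 : ℝ)..b, (1 / (i.factorial : ℝ)) * ((Real.log t - 0) ^ i / t) := by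
      refine intervalIntegral.integral_mono_on hb1 hfi hgi fun t ht => ?_
      have ht0 : 0 < t := by linarith [ht.1]
      have := ih t ht.1
      rw [sub_zero, show (1 / (i.factorial : ℝ)) * (Real.log t ^ i / t) = (Real.log t ^ i / i.factorial) / t
        by ring]
      exact div_le_div_of_nonneg_right this ht0.le
    refine hmono.trans ?_
    rw [intervalIntegral.integral_const_mul, integral_log_sub_pow_div i 0 one_pos hb1, Real.log_one,
      sub_zero, sub_zero, zero_pow (Nat.succ_ne_zero i), sub_zero, Nat.factorial_succ]
    push_cast
    have hfac : (0 : ℝ) < i.factorial := by exact_mod_cast i.factorial_pos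
    have hlogb : 0 ≤ Real.log b := Real.log_nonneg hb1
    have hlog : Real.log b ≤ Real.log u := Real.log_le_log hb0 hbu
    have hpow : Real.log b ^ (i + 1) ≤ Real.log u ^ (i + 1) := pow_le_pow_left₀ hlogb hlog _
    rw [show Real.log u ^ (i + 1) / ((↑i + 1) * ↑i.factorial) =
      1 / ↑i.factorial * (Real.log u ^ (i + 1) / (↑i + 1)) by rw [one_div_mul_eq_div, div_div]]
    exact mul_le_mul_of_nonneg_left (div_le_div_of_nonneg_right hpow (by positivity)) (by positivity)

/-- **Lower bound**: `(log u - i·log 2)^i / i! ≤ I_{i+1}(u)` for `u ≥ 2^i`. -/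
theorem pow_div_factorial_le_cellDensity (i : ℕ) :
    ∀ u : ℝ, (2 : ℝ) ^ i ≤ u → (Real.log u - i * Real.log 2) ^ i / i.factorial ≤ cellDensity i u := by
  induction i with
  | zero => intro u _; simp
  | succ i ih =>
    intro u hu
    set a : ℝ := (2 : ℝ) ^ i with ha
    have ha1 : 1 ≤ a := one_le_pow₀ (by norm_num)
    have ha0 : 0 < a := by linarith
    have hu2 : 2 ≤ u := by
      have : (2 : ℝ) ≤ 2 ^ (i + 1) := by
        calc (2 : ℝ) = 2 ^ 1 := by norm_num
          _ ≤ 2 ^ (i + 1) := pow_le_pow_right₀ (by norm_num) (by omega)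
      linarith
    have hmax : max (u - 1) 1 = u - 1 := max_eq_left (by linarith)
    have hab : a ≤ u - 1 := by
      have : (2 : ℝ) ^ (i + 1) = 2 * a := by rw [ha, pow_succ]; ring
      linarith
    rw [calc_cellDensity_succ, hmax]
    have hcont : ContinuousOn (fun t => cellDensity i t / t) (Ici 1) :=
      (calc_continuous i).continuousOn.div continuousOn_id fun t ht =>
        (lt_of_lt_of_le one_pos (show (1 : ℝ) ≤ t from ht)).ne'
    have hint : ∀ c d : ℝ, 1 ≤ c → 1 ≤ d → IntervalIntegrable (fun t => cellDensity i t / t) volume c d := by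
      intro c d hc hd
      refine (hcont.mono ?_).intervalIntegrable
      intro t ht
      rw [mem_uIcc] at ht
      rcases ht with h | h
      · exact le_trans hc h.1
      · exact le_trans hd h.1
    have hsplit : ∫ t in (1 : ℝ)..(u - 1), cellDensity i t / t =
        (∫ t in (1 : ℝ)..a, cellDensity i t / t) + ∫ t in a..(u - 1), cellDensity i t / t :=
      (intervalIntegral.integral_add_adjacent_intervals (hint 1 a le_rfl ha1)
        (hint a (u - 1) ha1 (by linarith))).symm
    have hfirst : 0 ≤ ∫ t in (1 : ℝ)..a, cellDensity i t / t :=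
      intervalIntegral.integral_nonneg ha1 fun t ht => div_nonneg (calc_nonneg i t) (by linarith [ht.1])
    -- comparison on `[a, u-1]`
    have hgi : IntervalIntegrable
        (fun t => (1 / (i.factorial : ℝ)) * ((Real.log t - i * Real.log 2) ^ i / t)) volume a (u - 1) := by
      refine ContinuousOn.intervalIntegrable ?_
      rw [uIcc_of_le hab]
      refine continuousOn_const.mul ?_
      refine ContinuousOn.div ((ContinuousOn.sub (Real.continuousOn_log.mono ?_) continuousOn_const).pow i)
        continuousOn_id fun x hx => ?_
      · intro x hx; exact (ne_of_gt (by linarith [hx.1] : (0 : ℝ) < x))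
      · exact (show (0 : ℝ) < x by linarith [hx.1]).ne'
    have hmono : ∫ t in a..(u - 1), (1 / (i.factorial : ℝ)) * ((Real.log t - i * Real.log 2) ^ i / t) ≤
        ∫ t in a..(u - 1), cellDensity i t / t := by
      refine intervalIntegral.integral_mono_on hab hgi (hint a (u - 1) ha1 (by linarith)) fun t ht => ?_
      have ht0 : 0 < t := by linarith [ht.1]
      have := ih t ht.1
      rw [show (1 / (i.factorial : ℝ)) * ((Real.log t - i * Real.log 2) ^ i / t) =
        ((Real.log t - i * Real.log 2) ^ i / i.factorial) / t by ring]
      exact div_le_div_of_nonneg_right this ht0.le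
    rw [intervalIntegral.integral_const_mul, integral_log_sub_pow_div i _ ha0 hab] at hmono
    have hloga : Real.log a - i * Real.log 2 = 0 := by
      rw [ha, Real.log_pow]; ring
    rw [hloga, zero_pow (Nat.succ_ne_zero i), sub_zero] at hmono
    -- `log (u-1) ≥ log u - log 2`
    have hlog : Real.log u - Real.log 2 ≤ Real.log (u - 1) := by
      rw [← Real.log_div (by linarith) (by norm_num)]
      exact Real.log_le_log (by linarith) (by linarith)
    have hnonneg : 0 ≤ Real.log u - (i + 1 : ℕ) * Real.log 2 := by
      have : Real.log ((2 : ℝ) ^ (i + 1)) ≤ Real.log u := Real.log_le_log (by positivity) hu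
      rw [Real.log_pow] at this
      linarith
    have hle : Real.log u - (i + 1 : ℕ) * Real.log 2 ≤ Real.log (u - 1) - i * Real.log 2 := by
      push_cast; linarith
    have hpow : (Real.log u - (i + 1 : ℕ) * Real.log 2) ^ (i + 1) ≤
        (Real.log (u - 1) - i * Real.log 2) ^ (i + 1) := pow_le_pow_left₀ hnonneg hle _
    have hfac : (0 : ℝ) < i.factorial := by exact_mod_cast i.factorial_pos
    calc (Real.log u - (i + 1 : ℕ) * Real.log 2) ^ (i + 1) / ((i + 1).factorial : ℝ)
        ≤ (Real.log (u - 1) - i * Real.log 2) ^ (i + 1) / ((i + 1).factorial : ℝ) :=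
          div_le_div_of_nonneg_right hpow (by positivity)
      _ = 1 / (i.factorial : ℝ) * ((Real.log (u - 1) - i * Real.log 2) ^ (i + 1) / (i + 1)) := by
          rw [Nat.factorial_succ]; push_cast; field_simp
      _ ≤ ∫ t in a..(u - 1), cellDensity i t / t := hmono
      _ ≤ _ := by rw [hsplit]; linarith

/-! ## The vanishing log-concavity margin at a bulk index -/

/-- **Margin.** If `(1-ε)(k+2) < k+1` (i.e. the bulk index `j = k+2` exceeds `1/ε`), then for all
large real `u`: `(1-ε)·I_{k+2}(u)² < I_{k+1}(u)·I_{k+3}(u)`. Proof: the upper bound for `I_{k+2}` and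
the lower bounds for `I_{k+1}, I_{k+3}` reduce it to `(1-ε)(k+2)·L^{2k+2} < (k+1)·(L-δ)^{2k+2}` with
`L = log u`, `δ = (k+2) log 2`, which holds as soon as `(1 - δ/L)^{2k+2} > (1-ε)(k+2)/(k+1)`. -/
theorem eventually_margin (ε : ℝ) (k : ℕ) (hk : (1 - ε) * ((k : ℝ) + 2) < k + 1) :
    ∀ᶠ u : ℝ in atTop,
      (1 - ε) * cellDensity (k + 1) u ^ 2 < cellDensity k u * cellDensity (k + 2) u := by
  rcases le_or_gt (1 - ε) 0 with hε | hε
  · -- trivial case: the left-hand side is `≤ 0`, the right-hand side is positive for `u > k+3`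
    filter_upwards [eventually_gt_atTop ((k : ℝ) + 3)] with u hu
    have h0 : 0 < cellDensity k u := calc_pos k u (by linarith)
    have h2 : 0 < cellDensity (k + 2) u := calc_pos (k + 2) u (by push_cast; linarith)
    have : (1 - ε) * cellDensity (k + 1) u ^ 2 ≤ 0 :=
      mul_nonpos_of_nonpos_of_nonneg hε (sq_nonneg _)
    linarith [mul_pos h0 h2]
  · set δ : ℝ := ((k : ℝ) + 2) * Real.log 2 with hδ
    set θ : ℝ := (1 - ε) * ((k : ℝ) + 2) / ((k : ℝ) + 1) with hθ
    have hk1 : (0 : ℝ) < (k : ℝ) + 1 := by positivity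
    have hθ1 : θ < 1 := by rw [hθ, div_lt_one hk1]; exact hk
    -- `(1 - δ/log u)^(2k+2) → 1`
    have hlim : Tendsto (fun u : ℝ => (1 - δ / Real.log u) ^ (2 * (k + 1))) atTop (nhds 1) := by
      have h1 : Tendsto (fun u : ℝ => δ / Real.log u) atTop (nhds 0) :=
        tendsto_const_nhds.div_atTop Real.tendsto_log_atTop
      have h2 := (tendsto_const_nhds (x := (1 : ℝ))).sub h1
      rw [sub_zero] at h2
      simpa using h2.pow (2 * (k + 1))
    filter_upwards [hlim.eventually (eventually_gt_nhds hθ1),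
      Real.tendsto_log_atTop.eventually (eventually_gt_atTop δ),
      eventually_ge_atTop ((2 : ℝ) ^ (k + 2))] with u hθu hδu hu2
    set L : ℝ := Real.log u with hL
    have hδ0 : 0 ≤ δ := by rw [hδ]; positivity
    have hL0 : 0 < L := lt_of_le_of_lt hδ0 hδu
    have hu1 : 1 ≤ u := le_trans (one_le_pow₀ (by norm_num)) hu2
    have huk : (2 : ℝ) ^ k ≤ u := le_trans (pow_le_pow_right₀ (by norm_num) (by omega)) hu2
    -- the three density bounds
    have hU : cellDensity (k + 1) u ≤ L ^ (k + 1) / (k + 1).factorial :=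
      cellDensity_le_pow_div_factorial (k + 1) u hu1
    have hLk : (L - k * Real.log 2) ^ k / k.factorial ≤ cellDensity k u :=
      pow_div_factorial_le_cellDensity k u huk
    have hLk2 : (L - (k + 2 : ℕ) * Real.log 2) ^ (k + 2) / (k + 2).factorial ≤ cellDensity (k + 2) u :=
      pow_div_factorial_le_cellDensity (k + 2) u hu2
    have hδ' : ((k + 2 : ℕ) : ℝ) * Real.log 2 = δ := by rw [hδ]; push_cast; ring
    rw [hδ'] at hLk2
    have hLδ : 0 ≤ L - δ := by linarith
    have hmonok : (L - δ) ^ k ≤ (L - k * Real.log 2) ^ k := by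
      refine pow_le_pow_left₀ hLδ ?_ _
      have : (k : ℝ) * Real.log 2 ≤ δ := by
        rw [hδ]; nlinarith [Real.log_pos (by norm_num : (1 : ℝ) < 2)]
      linarith
    -- `(1-ε)(k+2)·L^(2k+2) < (k+1)·(L-δ)^(2k+2)`
    have hfac : (L - δ) ^ (k + 1) = L ^ (k + 1) * (1 - δ / L) ^ (k + 1) := by
      rw [← mul_pow]; congr 1; field_simp
    have hsq : ((1 - δ / L) ^ (k + 1)) ^ 2 = (1 - δ / L) ^ (2 * (k + 1)) := by
      rw [← pow_mul, mul_comm]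
    have h1 : θ * (((k : ℝ) + 1) * (L ^ (k + 1)) ^ 2) <
        (1 - δ / L) ^ (2 * (k + 1)) * (((k : ℝ) + 1) * (L ^ (k + 1)) ^ 2) :=
      mul_lt_mul_of_pos_right hθu (by positivity)
    have h2 : (1 - δ / L) ^ (2 * (k + 1)) * (L ^ (k + 1)) ^ 2 = ((L - δ) ^ (k + 1)) ^ 2 := by
      rw [hfac, mul_pow, hsq]; ring
    have hθ' : (1 - ε) * ((k : ℝ) + 2) = θ * ((k : ℝ) + 1) := by
      rw [hθ]; field_simp
    have hkey : (1 - ε) * ((k : ℝ) + 2) * (L ^ (k + 1)) ^ 2 <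
        ((k : ℝ) + 1) * ((L - δ) ^ (k + 1)) ^ 2 := by
      rw [hθ', ← h2]; linarith [h1]
    -- factorials
    have hF1 : (((k + 1).factorial : ℕ) : ℝ) = ((k : ℝ) + 1) * k.factorial := by
      rw [Nat.factorial_succ]; push_cast; ring
    have hF2 : (((k + 2).factorial : ℕ) : ℝ) = ((k : ℝ) + 2) * (((k : ℝ) + 1) * k.factorial) := by
      rw [Nat.factorial_succ, Nat.factorial_succ]; push_cast; ring
    have hF0 : (0 : ℝ) < k.factorial := by exact_mod_cast k.factorial_pos
    have hc1 : 0 ≤ cellDensity (k + 1) u := calc_nonneg _ _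
    have hA : (L - δ) ^ k / k.factorial ≤ cellDensity k u :=
      (div_le_div_of_nonneg_right hmonok hF0.le).trans hLk
    -- assemble
    calc (1 - ε) * cellDensity (k + 1) u ^ 2
        ≤ (1 - ε) * (L ^ (k + 1) / (k + 1).factorial) ^ 2 :=
          mul_le_mul_of_nonneg_left (pow_le_pow_left₀ hc1 hU 2) hε.le
      _ < ((L - δ) ^ k / k.factorial) * ((L - δ) ^ (k + 2) / (k + 2).factorial) := by
          rw [hF1, hF2, div_pow, div_mul_div_comm, ← pow_add,
            show k + (k + 2) = (k + 1) * 2 by ring, pow_mul,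
            mul_div_assoc', div_lt_div_iff₀ (by positivity) (by positivity)]
          have hpos : (0 : ℝ) < ((k : ℝ) + 1) * (k.factorial : ℝ) ^ 2 := by positivity
          nlinarith [mul_lt_mul_of_pos_right hkey hpos]
      _ ≤ cellDensity k u * cellDensity (k + 2) u :=
          mul_le_mul hA hLk2 (div_nonneg (pow_nonneg hLδ _) (Nat.cast_nonneg _)) (calc_nonneg _ _)

end Summit.Parity.GeneralizedHardyLittlewood.Theorems.ModelCellFacts

end
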